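import Mathlib
import HarnessLib

/-!
# Coefficients of a finite sum of distinct powers are controlled by its `L²(1,2)` norm

Analysis/Calculus support file (everything proved). For exponents `m − s`, `m = 0, …, N`
(`s ∈ ℝ` fixed) the powers `x^{m−s}` are linearly independent on `(1,2)` (a polynomial with
infinitely many roots vanishes), so by compactness of the unit sphere of `ℝ^{N+1}` the positive
quadratic form `α ↦ ∫_1^2 (Σ_m α_m x^{m−s})² dx` dominates `Σ_m α_m²`
(`powerSum_sq_coeff_le_integral`). Adding the weight `n(n+1)x⁻² ≥ n(n+1)/4` on `[1,2]` gives the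
energy form of the data `x^{m−n}` of the non-radiative solutions of
`ψ_tt − ψ_xx + n(n+1)x⁻²ψ = 0` (`powerSum_sq_coeff_le_energy`, `n ≥ 1`). This is the norm
equivalence on the finite-dimensional kernel used in the far-side channel estimate of
`FixedModeChannels` (route PhotonSphereChannels, stmt-FinalStateConjecture-10048). Folklore.
-/

noncomputable section

namespace Literature.Analysis.Calculus

open MeasureTheory Set Filter Topology Finset Real Polynomial

/-- Linear independence of distinct powers on `(1,2)`: if `Σ_{m≤N} α_m x^{m−s} = 0` on `(1,2)`
then `α = 0` on `range (N+1)`. [folklore] -/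
theorem powerSum_coeff_eq_zero {N : ℕ} {s : ℝ} {α : ℕ → ℝ}
    (h : ∀ x ∈ Ioo (1 : ℝ) 2, ∑ m ∈ range (N + 1), α m * x ^ ((m : ℝ) - s) = 0) :
    ∀ m ∈ range (N + 1), α m = 0 := by
  set p : ℝ[X] := ∑ m ∈ range (N + 1), C (α m) * X ^ m with hp
  have hroot : ∀ x ∈ Ioo (1 : ℝ) 2, IsRoot p x := by
    intro x hx
    have hx0 : 0 < x := by linarith [hx.1]
    have h1 := h x hx
    have h2 : ∑ m ∈ range (N + 1), α m * x ^ m = x ^ s * ∑ m ∈ range (N + 1),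
        α m * x ^ ((m : ℝ) - s) := by
      rw [Finset.mul_sum]
      refine Finset.sum_congr rfl fun m _ => ?_
      rw [rpow_sub hx0, rpow_natCast]
      field_simp
    simp only [IsRoot, hp, eval_finsetSum, eval_mul, eval_C, eval_pow, eval_X, h2, h1, mul_zero]
  have hp0 : p = 0 := eq_zero_of_infinite_isRoot p ((Ioo_infinite (by norm_num)).mono hroot)
  intro m hm
  have hc : p.coeff m = α m := by
    simp only [hp, finsetSum_coeff, coeff_C_mul, coeff_X_pow]
    rw [Finset.sum_eq_single m (fun k _ hk => by simp [Ne.symm hk]) (fun h => absurd hm h)]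
    simp
  rw [← hc, hp0, coeff_zero]

/-- **Coefficients are controlled by the `L²(1,2)` norm of a power sum.** [folklore] -/
theorem powerSum_sq_coeff_le_integral (N : ℕ) (s : ℝ) :
    ∃ C : ℝ, 0 < C ∧ ∀ α : ℕ → ℝ,
      ∑ m ∈ range (N + 1), α m ^ 2
        ≤ C * ∫ x in (1:ℝ)..2, (∑ m ∈ range (N + 1), α m * x ^ ((m : ℝ) - s)) ^ 2 := by
  -- globally continuous basis functions agreeing with the powers on `[1,2]`
  set b : ℕ → ℝ → ℝ := fun m x => (max x (1 / 2)) ^ ((m : ℝ) - s) with hb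
  have hbc : ∀ m, Continuous (b m) := fun m =>
    (continuous_id.max continuous_const).rpow_const fun x => Or.inl (by positivity)
  have hbeq : ∀ m, ∀ x ∈ Icc (1 : ℝ) 2, b m x = x ^ ((m : ℝ) - s) := fun m x hx => by
    simp only [hb, max_eq_left (by linarith [hx.1] : (1 / 2 : ℝ) ≤ x)]
  -- the quadratic form on `ℝ^{N+1}`
  set E := EuclideanSpace ℝ (Fin (N + 1))
  set S : E → ℝ → ℝ := fun v x => ∑ i : Fin (N + 1), v i * b i x with hS
  set F : E → ℝ := fun v => ∫ x in (1:ℝ)..2, (S v x) ^ 2 with hF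
  have hSc : Continuous (Function.uncurry S) := by
    simp only [hS]
    refine continuous_finsetSum _ fun i _ => ?_
    exact ((continuous_apply i).comp ((PiLp.continuous_ofLp 2 _).comp continuous_fst)).mul
      ((hbc i).comp continuous_snd)
  have hFc : Continuous F :=
    intervalIntegral.continuous_parametric_intervalIntegral_of_continuous' (μ := volume)
      (hSc.pow 2) 1 2
  -- coefficients of a vector as a sequence
  have hsumv : ∀ (v : E) (x : ℝ), S v x = ∑ m ∈ range (N + 1),
      (fun m => if h : m < N + 1 then v ⟨m, h⟩ else 0) m * b m x := by
    intro v x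
    simp only [hS]
    rw [Finset.sum_range (fun m => (if h : m < N + 1 then v ⟨m, h⟩ else 0) * b m x)]
    refine Finset.sum_congr rfl fun i _ => ?_
    simp [i.2]
  -- positivity off the origin
  have hFpos : ∀ v : E, v ≠ 0 → 0 < F v := by
    intro v hv
    have hint : IntervalIntegrable (fun x => S v x ^ 2) volume 1 2 :=
      ((hSc.uncurry_left v).pow 2).intervalIntegrable _ _
    -- `S v` does not vanish identically on `(1,2)`
    have hex : ∃ x₀ ∈ Ioo (1 : ℝ) 2, S v x₀ ≠ 0 := by
      by_contra hne
      have hzero : ∀ x ∈ Ioo (1 : ℝ) 2, S v x = 0 := fun x hx => by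
        by_contra h'; exact hne ⟨x, hx, h'⟩
      have hcoef := powerSum_coeff_eq_zero (N := N) (s := s)
        (α := fun m => if h : m < N + 1 then v ⟨m, h⟩ else 0) (fun x hx => by
          have h0 := hzero x hx
          rw [hsumv] at h0
          have e1 : ∑ m ∈ range (N + 1), (fun m => if h : m < N + 1 then v ⟨m, h⟩ else 0) m
              * x ^ ((m : ℝ) - s) = ∑ m ∈ range (N + 1),
                (fun m => if h : m < N + 1 then v ⟨m, h⟩ else 0) m * b m x :=
            Finset.sum_congr rfl fun m _ => by rw [hbeq m x (Ioo_subset_Icc_self hx)]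
          exact e1.trans h0)
      apply hv
      ext i
      have := hcoef i (mem_range.2 i.2)
      simp only [i.2, dif_pos] at this
      simpa using this
    obtain ⟨x₀, hx₀, hSx₀⟩ := hex
    simp only [hF]
    rw [intervalIntegral.integral_of_le (by norm_num : (1:ℝ) ≤ 2),
      setIntegral_pos_iff_support_of_nonneg_ae (ae_of_all _ fun x => sq_nonneg _) hint.1]
    have hopen : IsOpen {x | S v x ^ 2 ≠ 0} :=
      isOpen_ne_fun ((hSc.uncurry_left v).pow 2) continuous_const
    have hx₀mem : x₀ ∈ {x | S v x ^ 2 ≠ 0} ∩ Ioo 1 2 := ⟨by simpa using hSx₀, hx₀⟩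
    have hO : IsOpen ({x | S v x ^ 2 ≠ 0} ∩ Ioo 1 2) := hopen.inter isOpen_Ioo
    calc (0 : ENNReal) < volume ({x | S v x ^ 2 ≠ 0} ∩ Ioo 1 2) :=
          hO.measure_pos volume ⟨x₀, hx₀mem⟩
      _ ≤ volume (Function.support (fun x => S v x ^ 2) ∩ Ioc 1 2) :=
          measure_mono (inter_subset_inter (fun x hx => hx) Ioo_subset_Ioc_self)
  -- homogeneity
  have hSsmul : ∀ (c : ℝ) (v : E) (x : ℝ), S (c • v) x = c * S v x := by
    intro c v x
    simp only [hS, Finset.mul_sum]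
    refine Finset.sum_congr rfl fun i _ => ?_
    rw [PiLp.smul_apply, smul_eq_mul, mul_assoc]
  have hFhom : ∀ (c : ℝ) (v : E), F (c • v) = c ^ 2 * F v := by
    intro c v
    simp only [hF]
    rw [← intervalIntegral.integral_const_mul]
    refine intervalIntegral.integral_congr fun x _ => ?_
    simp only [hSsmul]
    ring
  -- minimum on the unit sphere
  have hsph : IsCompact (Metric.sphere (0 : E) 1) := isCompact_sphere _ _
  have hne : (Metric.sphere (0 : E) 1).Nonempty := by
    refine ⟨EuclideanSpace.single (0 : Fin (N + 1)) (1 : ℝ), ?_⟩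
    rw [mem_sphere_zero_iff_norm, PiLp.norm_single, norm_one]
  obtain ⟨v₀, hv₀, hmin⟩ := hsph.exists_isMinOn hne hFc.continuousOn
  have hv₀ne : v₀ ≠ 0 := by
    intro h; rw [h] at hv₀; simp at hv₀
  set c₀ := F v₀ with hc₀
  have hc₀pos : 0 < c₀ := hFpos v₀ hv₀ne
  have hlow : ∀ v : E, c₀ * ‖v‖ ^ 2 ≤ F v := by
    intro v
    rcases eq_or_ne v 0 with h | h
    · subst h; simp only [norm_zero]; rw [zero_pow two_ne_zero, mul_zero]
      exact intervalIntegral.integral_nonneg (by norm_num) fun x _ => sq_nonneg _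
    · have hn : ‖v‖ ≠ 0 := norm_ne_zero_iff.2 h
      have hnpos : 0 < ‖v‖ := norm_pos_iff.2 h
      have hu : ‖v‖⁻¹ • v ∈ Metric.sphere (0 : E) 1 := by
        rw [mem_sphere_zero_iff_norm, norm_smul, norm_inv, norm_norm, inv_mul_cancel₀ hn]
      have h1 : c₀ ≤ F (‖v‖⁻¹ • v) := hmin hu
      rw [hFhom] at h1
      have h3 : ‖v‖ ^ 2 * (‖v‖⁻¹ ^ 2 * F v) = F v := by field_simp
      calc c₀ * ‖v‖ ^ 2 = ‖v‖ ^ 2 * c₀ := mul_comm _ _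
        _ ≤ ‖v‖ ^ 2 * (‖v‖⁻¹ ^ 2 * F v) := mul_le_mul_of_nonneg_left h1 (sq_nonneg _)
        _ = F v := h3
  -- back to coefficient sequences
  refine ⟨c₀⁻¹, inv_pos.2 hc₀pos, fun α => ?_⟩
  set v : E := (WithLp.equiv 2 (Fin (N + 1) → ℝ)).symm fun i => α i with hv
  have hvi : ∀ i : Fin (N + 1), v i = α i := fun i => rfl
  have hnorm : ‖v‖ ^ 2 = ∑ m ∈ range (N + 1), α m ^ 2 := by
    rw [EuclideanSpace.real_norm_sq_eq, Finset.sum_range (fun m => α m ^ 2)]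
    exact Finset.sum_congr rfl fun i _ => by rw [hvi]
  have hFv : F v = ∫ x in (1:ℝ)..2, (∑ m ∈ range (N + 1), α m * x ^ ((m : ℝ) - s)) ^ 2 := by
    simp only [hF]
    refine intervalIntegral.integral_congr fun x hx => ?_
    rw [uIcc_of_le (by norm_num : (1:ℝ) ≤ 2)] at hx
    show S v x ^ 2 = _
    rw [hsumv v x]
    congr 1
    refine Finset.sum_congr rfl fun m hm => ?_
    show (if h : m < N + 1 then v ⟨m, h⟩ else 0) * b m x = α m * x ^ ((m : ℝ) - s)
    rw [dif_pos (mem_range.1 hm), hbeq m x hx]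
    rfl
  have h := hlow v
  rw [hnorm, hFv] at h
  rw [inv_mul_eq_div, le_div_iff₀ hc₀pos]
  linarith

/-- **Energy form (`n ≥ 1`).**
`Σ α_m² ≤ C ∫_1^2 [(Σ α_m (m−n) x^{m−n−1})² + n(n+1)x⁻²(Σ α_m x^{m−n})²]`. [folklore] -/
theorem powerSum_sq_coeff_le_energy (N : ℕ) {n : ℕ} (hn : 1 ≤ n) :
    ∃ C : ℝ, 0 < C ∧ ∀ α : ℕ → ℝ,
      ∑ m ∈ range (N + 1), α m ^ 2
        ≤ C * ∫ x in (1:ℝ)..2,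
          ((∑ m ∈ range (N + 1), α m * ((m : ℝ) - n) * x ^ ((m : ℝ) - n - 1)) ^ 2
            + (n : ℝ) * (n + 1) * x ^ (-(2 : ℝ))
              * (∑ m ∈ range (N + 1), α m * x ^ ((m : ℝ) - n)) ^ 2) := by
  obtain ⟨C, hC, hle⟩ := powerSum_sq_coeff_le_integral N n
  have hn1 : (1 : ℝ) ≤ n := by exact_mod_cast hn
  refine ⟨4 * C / ((n : ℝ) * (n + 1)), by positivity, fun α => ?_⟩
  have h1 := hle α
  -- the weight `n(n+1) x⁻² ≥ n(n+1)/4` on `[1,2]`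
  have hcont1 : Continuous fun x : ℝ => (∑ m ∈ range (N + 1),
      α m * (max x (1 / 2)) ^ ((m : ℝ) - n)) ^ 2 := by
    refine (continuous_finsetSum _ fun m _ => continuous_const.mul
      ((continuous_id.max continuous_const).rpow_const fun x => Or.inl (by positivity))).pow 2
  have hcont2 : Continuous fun x : ℝ => (∑ m ∈ range (N + 1),
      α m * ((m : ℝ) - n) * (max x (1 / 2)) ^ ((m : ℝ) - n - 1)) ^ 2
      + (n : ℝ) * (n + 1) * (max x (1 / 2)) ^ (-(2 : ℝ))
        * (∑ m ∈ range (N + 1), α m * (max x (1 / 2)) ^ ((m : ℝ) - n)) ^ 2 := by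
    have hm : Continuous fun x : ℝ => max x (1 / 2) := continuous_id.max continuous_const
    have hr : ∀ e : ℝ, Continuous fun x : ℝ => (max x (1 / 2)) ^ e := fun e =>
      hm.rpow_const fun x => Or.inl (by positivity)
    exact ((continuous_finsetSum _ fun m _ => continuous_const.mul (hr _)).pow 2).add
      ((continuous_const.mul (hr _)).mul ((continuous_finsetSum _ fun m _ =>
        continuous_const.mul (hr _)).pow 2))
  have key : (∫ x in (1:ℝ)..2, (∑ m ∈ range (N + 1), α m * x ^ ((m : ℝ) - n)) ^ 2)
      ≤ (4 / ((n : ℝ) * (n + 1))) * ∫ x in (1:ℝ)..2,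
          ((∑ m ∈ range (N + 1), α m * ((m : ℝ) - n) * x ^ ((m : ℝ) - n - 1)) ^ 2
            + (n : ℝ) * (n + 1) * x ^ (-(2 : ℝ))
              * (∑ m ∈ range (N + 1), α m * x ^ ((m : ℝ) - n)) ^ 2) := by
    rw [← intervalIntegral.integral_const_mul]
    have hmax : ∀ x ∈ Icc (1:ℝ) 2, max x (1 / 2) = x := fun x hx => max_eq_left (by linarith [hx.1])
    refine intervalIntegral.integral_mono_on (by norm_num) ?_ ?_ fun x hx => ?_
    · refine (hcont1.intervalIntegrable 1 2).congr ?_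
      rw [uIoc_of_le (by norm_num : (1:ℝ) ≤ 2)]
      intro x hx
      simp only [hmax x (Ioc_subset_Icc_self hx)]
    · refine ((hcont2.intervalIntegrable 1 2).congr ?_).const_mul _
      rw [uIoc_of_le (by norm_num : (1:ℝ) ≤ 2)]
      intro x hx
      simp only [hmax x (Ioc_subset_Icc_self hx)]
    · have hx0 : 0 < x := by linarith [hx.1]
      have hw : 1 / 4 ≤ x ^ (-(2 : ℝ)) := by
        rw [rpow_neg hx0.le, rpow_two]
        rw [div_le_iff₀ (by norm_num : (0:ℝ) < 4), inv_mul_eq_div, le_div_iff₀ (by positivity)]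
        nlinarith [hx.1, hx.2]
      set A := (∑ m ∈ range (N + 1), α m * x ^ ((m : ℝ) - n)) ^ 2
      set B := (∑ m ∈ range (N + 1), α m * ((m : ℝ) - n) * x ^ ((m : ℝ) - n - 1)) ^ 2
      have hA : 0 ≤ A := sq_nonneg _
      have hB : 0 ≤ B := sq_nonneg _
      have hnn : 0 < (n : ℝ) * (n + 1) := by positivity
      rw [show (4 / ((n : ℝ) * (n + 1))) * (B + (n : ℝ) * (n + 1) * x ^ (-(2 : ℝ)) * A)
        = 4 / ((n : ℝ) * (n + 1)) * B + 4 * x ^ (-(2 : ℝ)) * A by field_simp]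
      nlinarith [mul_nonneg hB (by positivity : (0:ℝ) ≤ 4 / ((n : ℝ) * (n + 1)))]
  calc ∑ m ∈ range (N + 1), α m ^ 2
      ≤ C * ∫ x in (1:ℝ)..2, (∑ m ∈ range (N + 1), α m * x ^ ((m : ℝ) - n)) ^ 2 := h1
    _ ≤ C * ((4 / ((n : ℝ) * (n + 1))) * ∫ x in (1:ℝ)..2,
          ((∑ m ∈ range (N + 1), α m * ((m : ℝ) - n) * x ^ ((m : ℝ) - n - 1)) ^ 2
            + (n : ℝ) * (n + 1) * x ^ (-(2 : ℝ))
              * (∑ m ∈ range (N + 1), α m * x ^ ((m : ℝ) - n)) ^ 2)) :=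
        mul_le_mul_of_nonneg_left key hC.le
    _ = 4 * C / ((n : ℝ) * (n + 1)) * ∫ x in (1:ℝ)..2,
          ((∑ m ∈ range (N + 1), α m * ((m : ℝ) - n) * x ^ ((m : ℝ) - n - 1)) ^ 2
            + (n : ℝ) * (n + 1) * x ^ (-(2 : ℝ))
              * (∑ m ∈ range (N + 1), α m * x ^ ((m : ℝ) - n)) ^ 2) := by ring

end Literature.Analysis.Calculus
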